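import Summits.BirchSwinnertonDyer.BirchSwinnertonDyer.Theorems.EisensteinPrimesBSDpOnCellCOfThmD
import Summits.BirchSwinnertonDyer.BirchSwinnertonDyer.Theorems.EisensteinPrimesBSDpOnCellCNotGVDoors
import HarnessLib

/-!
# Crux 4 `BSDpOnCellC` (stmt-BirchSwinnertonDyer-19034), line b1 v9: the ψ-EVEN DOORS AT THE PRE TIER —
# `BSD(E,p)` on `CellC ∩ {¬ GVPar}` from the 16 published facts + [cas-split] and KELLER–YIN THM. D BY NAME,
# with NO crux 3 and, at `p ≥ 5`, NO value atom (cell `bsd-eis`, seat `bsd-eis-cgshw` g13; part 3 of 3 —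
# parts 1–2 = `…SplitPartner.lean`, `…NotGVDoors.lean`)

HONEST FRAMING (cell `bsd-eis`, run/shared/lean/pub/bsd-eis/): four conditional theorems; nothing booked; X2 stays
CONSTRUCTION-SHAPED; no label or count moves; BSD is not proved by any of this. The theorems are CONDITIONAL on
(i) sixteen published named facts and [cas-split] (fact-grade; = v9's `stub_publishedFacts` VERBATIM), (ii)
**`KellerYin2024.thmD_imcMult_exists_isBDPLFunction_isTorsion_charIdeal_eq_OPEN`** — Keller–Yin
arXiv:2402.12781v2 Thm. D = Thm. 5.1.3, an UNREFEREED PREPRINT whose printed proof is gapped at L1754 (flag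
`KYD-gap`), taken BY NAME —, and (iii) in the all-`p` theorem only, the value atom c2 at `3 ‖ N` (= v9's
`stub_c2` VERBATIM; NOT in print; two memo-level derivations on file, RULING L11 (G6)). Compared with
`Reoriented.bsdpOnCellC_of_thmD_OPEN` (p489431: ALL of cell C, carrying `stub_c2` AND crux 3 `MazurMCOnCellB`),
the ψ-even half of cell C needs NO crux 3 (the CGLS partner is ψ-odd, in the CLOSED sub-cell X2a), and at
`p ≥ 5` no value atom either ([cas-split]). Census reading (no label moves here; the planner's and referee B's
call): ψ-even B11 cells at `p ∈ {5, 7}` — `CellCNonsplitNotGV` 93 + 17, `CellCSplitNotGV` 280 + 19 = 409 —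
are LITERAL on the single preprint input Keller–Yin Thm. D, class-wide, membership = the N9 atlas `gvpar` bit;
the 9 981 ψ-even cells at `p = 3` are literal on {Thm. D, c2@3}. §5 adds the sign- and parity-free form:
`bsdpOnCellC_of_imcIntOther_of_gvPartner` / `bsdpOnCellC_of_thmD_OPEN_of_gvPartner` = crux 4 `BSDpOnCellC` BY NAME
with crux 3 `MazurMCOnCellB` replaced by the rank-zero `p`-part of the admissible quadratic twists of the ψ-ODD
X2c curves ONLY — the exact residual need of crux 4 from rung K5. Nothing here asserts Thm. D.

References: [KellerYin2024] Thm. D = Thm. 5.1.3 (arXiv:2402.12781v2 L306–L309, L1725–L1780; PRE);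
[GreenbergVatsal2000] Thm. (1.3), §2 p. 28; [Castella2018Exceptional] Thms. 2.10–2.11; [Hsieh2014] Thm. 1;
[CastellaEtAl2021] Thm. 5.3.1; [Miller2011LMS] Def. 1.1; RULINGS L31 / L32 / L33 / L34.
-/

set_option autoImplicit false
set_option linter.dupNamespace false

noncomputable section

open scoped Classical MatrixGroups ModularForm Topology

open Filter CongruenceSubgroup WeierstrassCurve NumberField IsDedekindDomain Field PowerSeries
  Literature.NumberTheory.EllipticCurves Literature.NumberTheory.EllipticCurves.GreenbergSelmer
  Literature.NumberTheory.EllipticCurves.ModularForms Literature.NumberTheory.QuadraticFields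
  Literature.NumberTheory.EllipticCurves.Rank1Residual
  Literature.NumberTheory.EllipticCurves.Rank1Residual.Typed
  Literature.NumberTheory.EllipticCurves.KrizLi2019
  Literature.NumberTheory.EllipticCurves.GreenbergVatsal2000
  Literature.NumberTheory.EllipticCurves.Wuthrich2014
  Literature.NumberTheory.EllipticCurves.SteinWuthrich2013
  Literature.NumberTheory.EllipticCurves.Castella2018
  Literature.NumberTheory.EllipticCurves.Castella2018Exceptional
  Literature.NumberTheory.GaloisRepresentations Literature.NumberTheory.GaloisCohomology
  Literature.NumberTheory.Automorphic
  Summit.BirchSwinnertonDyer.Rank1Residual.X11b.AcSelmer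
  Summit.BirchSwinnertonDyer.Rank1Residual.X11b.Halves
  Summit.BirchSwinnertonDyer.Rank1Residual.X11b
  Summit.BirchSwinnertonDyer.Rank1Residual.X2
  Summit.BirchSwinnertonDyer.Rank1Residual

namespace Summit.BirchSwinnertonDyer.BirchSwinnertonDyer.Theorems.Reoriented

/-! ### §4 BY NAME at the PRE tier: Keller–Yin Thm. D for the IMC atom; nothing for the partner -/

section OfThmD

/-- **`CellC ∩ {¬ GVPar}` at `p ≥ 5` ⇒ `BSD(E,p)` from the 16 published facts + [cas-split] (`hPub`, = v9's
`stub_publishedFacts` VERBATIM) and KELLER–YIN THM. D BY NAME (`hD`, PREPRINT, gapped at L1754) — NOTHING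
ELSE: no value atom, no crux 3, no per-pair certificate.** The re-oriented `stub_c3` slot of
`bsdpOnCellCNotGV_of_imcIntOther_of_five_le` is filled by
`⟨X2.forall_nonsplitIMCEqOnTreeIntOther_of_thmD_OPEN hD, X2.forall_splitIMCEqOnTreeIntOther_of_thmD_OPEN hD⟩`
(p487050). Reading for the census (no label moves here): on the ψ-even B11 sub-rows at `p ∈ {5, 7}`
(`CellCNonsplitNotGV` 93 + 17, `CellCSplitNotGV` 280 + 19 = 409 cells) `BSD(E,p)` is LITERAL on the single
preprint input Keller–Yin Thm. D; membership = the N9 atlas `gvpar` bit. A `conditional-result`: it credits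
nothing and books nothing. [claim: KellerYin2024, status: under-review]
[cite: KellerYin2024, Thm. D = Thm. 5.1.3 (arXiv:2402.12781v2 L306–L309)] [cite: GreenbergVatsal2000, Thm. (1.3) and §2 p. 28]
[cite: Castella2018Exceptional, Thm. 2.10 and Thm. 2.11 (arXiv:1507.04260 pp. 13–14)]
[cite: Hsieh2014, Thm. 1 (arXiv:1112.1580 pp. 3–4)] [cite: CastellaEtAl2021, Thm. 5.3.1] [cite: Miller2011LMS, Def. 1.1] -/
theorem bsdpOnCellCNotGV_of_thmD_OPEN_of_five_le
    (hPub : (lambdaMu_multiplicative_of_gvPar ∧ thm16_charIdeal_dvd_multiplicative_of_reducible ∧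
      thm61_splitMultiplicative ∧ thm61_nonsplitMultiplicative ∧
      (∀ (W : WeierstrassCurve ℚ) [W.IsElliptic] [W.IsGloballyMinimal] (p : ℕ) [Fact p.Prime],
        greenberg_stevens (W := W) (p := p)) ∧
      exists_isNewformOf ∧
      (∀ (K : Type) [Field K] [NumberField K], poitouTate_selmerStructure_duality K) ∧
      (∀ (K : Type) [Field K] [NumberField K], poitouTate_sha_tateDual K) ∧
      hsieh2014_exists_anticyclotomicPAdicLFunction ∧
      (∀ (N : ℕ) [NeZero N] (W : WeierstrassCurve ℚ) (K : Type) [Field K] [NumberField K],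
        gross_zagier N W K) ∧
      (∀ (N : ℕ) [NeZero N] (W : WeierstrassCurve ℚ) (K : Type) [Field K] [NumberField K],
        kolyvagin N W K) ∧
      rank_eq_analyticRank_of_analyticRank_le_one ∧ HoffsteinLuo1997_exists_twist_L_one_ne_zero ∧
      mazur_not_dvd_maninConstant_of_odd ∧ bsdRHS_eq_of_isIsogenous) ∧
      thm210_thm211_bdpDisplay_pNew)
    (hD : KellerYin2024.thmD_imcMult_exists_isBDPLFunction_isTorsion_charIdeal_eq_OPEN) :
    ∀ (W : WeierstrassCurve ℚ) [W.IsElliptic] [W.IsGloballyMinimal] (p : ℕ) [Fact p.Prime],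
      5 ≤ p → CellC W p → ¬ GVPar W p → BSDp W p :=
  bsdpOnCellCNotGV_of_imcIntOther_of_five_le hPub
    ⟨forall_nonsplitIMCEqOnTreeIntOther_of_thmD_OPEN hD, forall_splitIMCEqOnTreeIntOther_of_thmD_OPEN hD⟩

/-- **`CellC ∩ {¬ GVPar}` at every odd `p` ⇒ `BSD(E,p)` from the 16 published facts + [cas-split] (`hPub`),
the value atom at `p = 3` both signs (`h2`, = v9's `stub_c2` VERBATIM; NOT in print) and Keller–Yin Thm. D BY
NAME (`hD`, PREPRINT) — NO crux 3.** `bsdpOnCellCNotGV_of_imcIntOther` with the re-oriented `stub_c3` slot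
filled from `hD` by name (p487050). Reading for the census (no label moves here): on ALL ψ-even B11 cells
(9 981 @3 + 409 @5/@7) crux 4's residue is {Thm. D [PRE]} ∪ {c2@3 [memo-level roads HK / LZZ]} — crux 3
`MazurMCOnCellB` is NOT an input there. A `conditional-result`: it credits nothing and books nothing.
[claim: KellerYin2024, status: under-review] [cite: KellerYin2024, Thm. D = Thm. 5.1.3 (arXiv:2402.12781v2 L306–L309)]
[cite: GreenbergVatsal2000, Thm. (1.3) and §2 p. 28] [cite: Hsieh2014, Thm. 1 (arXiv:1112.1580 pp. 3–4)]
[cite: CastellaEtAl2021, Thm. 5.3.1] [cite: Miller2011LMS, Def. 1.1] -/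
theorem bsdpOnCellCNotGV_of_thmD_OPEN
    (hPub : (lambdaMu_multiplicative_of_gvPar ∧ thm16_charIdeal_dvd_multiplicative_of_reducible ∧
      thm61_splitMultiplicative ∧ thm61_nonsplitMultiplicative ∧
      (∀ (W : WeierstrassCurve ℚ) [W.IsElliptic] [W.IsGloballyMinimal] (p : ℕ) [Fact p.Prime],
        greenberg_stevens (W := W) (p := p)) ∧
      exists_isNewformOf ∧
      (∀ (K : Type) [Field K] [NumberField K], poitouTate_selmerStructure_duality K) ∧
      (∀ (K : Type) [Field K] [NumberField K], poitouTate_sha_tateDual K) ∧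
      hsieh2014_exists_anticyclotomicPAdicLFunction ∧
      (∀ (N : ℕ) [NeZero N] (W : WeierstrassCurve ℚ) (K : Type) [Field K] [NumberField K],
        gross_zagier N W K) ∧
      (∀ (N : ℕ) [NeZero N] (W : WeierstrassCurve ℚ) (K : Type) [Field K] [NumberField K],
        kolyvagin N W K) ∧
      rank_eq_analyticRank_of_analyticRank_le_one ∧ HoffsteinLuo1997_exists_twist_L_one_ne_zero ∧
      mazur_not_dvd_maninConstant_of_odd ∧ bsdRHS_eq_of_isIsogenous) ∧
      thm210_thm211_bdpDisplay_pNew)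
    (h2 : (∀ (W : WeierstrassCurve ℚ) [W.IsElliptic] [W.IsGloballyMinimal] (p : ℕ) [Fact p.Prime],
        p = 3 → CellC W p → ¬ W.HasSplitMultiplicativeReductionAtPrime p → NonsplitBDPValueOnTreeInt W p) ∧
      (∀ (W : WeierstrassCurve ℚ) [W.IsElliptic] [W.IsGloballyMinimal] (p : ℕ) [Fact p.Prime],
        p = 3 → CellC W p → W.HasSplitMultiplicativeReductionAtPrime p → SplitBDPValueOnTreeInt W p))
    (hD : KellerYin2024.thmD_imcMult_exists_isBDPLFunction_isTorsion_charIdeal_eq_OPEN) :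
    ∀ (W : WeierstrassCurve ℚ) [W.IsElliptic] [W.IsGloballyMinimal] (p : ℕ) [Fact p.Prime],
      CellC W p → ¬ GVPar W p → BSDp W p :=
  bsdpOnCellCNotGV_of_imcIntOther hPub h2
    ⟨forall_nonsplitIMCEqOnTreeIntOther_of_thmD_OPEN hD, forall_splitIMCEqOnTreeIntOther_of_thmD_OPEN hD⟩

/-! ### §5 The whole of cell C with the partner SUPPLIED on the ψ-odd half only: what crux 4 consumes of K5 -/

/-- **Crux 4 `BSDpOnCellC` from v9's `stub_publishedFacts` / `stub_c2` / re-oriented `stub_c3` VERBATIM and, in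
place of crux 3 `MazurMCOnCellB`, ONLY the rank-zero `p`-part of the admissible quadratic twists of the ψ-ODD
X2c curves (`hGVp`).** This is the exact residual need of crux 4 from rung K5: for a ψ-EVEN pair the partner is
supplied by `X2.pPartRankZero_twist_of_not_gvPar` (CLOSED sub-cell X2a); for a ψ-ODD pair (`GVPar W p`) the
CGLS partner `E^{(d_K)}` — a rank-zero X2b pair of the same split type, conductor `N·d_K²` — is asked for as
`PPartRankZero`, which `MazurMCOnCellB` implies (`bsdp_of_mazurMainConjectureAt_of_analyticRank_eq_zero`, as in
p488773) but which is strictly weaker as a statement. Proof: the eight proved inputs by name; Manin move to the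
optimal curve (`X2.bsdp_of_cellC_of_forall_isIsogenous`); `GVPar` / `¬GVPar` carried along the isogeny by the
Tate-free `KernelDisc.gvPar_iff_of_isIsogenous_of_hasMultiplicativeReduction`; sign × (`5 ≤ p` / `p = 3`) over
the four `…_of_partner` roads (p488442 / p488440 non-split, `…SplitPartner.lean` split). CONDITIONAL on every
listed binder; nothing booked; X2 CONSTRUCTION-SHAPED; no label change.
[cite: GreenbergVatsal2000, Thm. (1.3) and §2 p. 28] [cite: SerreInventiones1972, §1.12]
[cite: Castella2018Exceptional, Thm. 2.10 and Thm. 2.11 (arXiv:1507.04260 pp. 13–14)]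
[cite: Hsieh2014, Thm. 1 (arXiv:1112.1580 pp. 3–4)] [claim: KellerYin2024, status: under-review]
[cite: CastellaEtAl2021, Thm. 5.3.1] [cite: Mazur1978, Cor. 4.1] [cite: MilneADT2006, Thm. I.7.3]
[cite: Miller2011LMS, Def. 1.1] -/
theorem bsdpOnCellC_of_imcIntOther_of_gvPartner
    (hPub : (lambdaMu_multiplicative_of_gvPar ∧ thm16_charIdeal_dvd_multiplicative_of_reducible ∧
      thm61_splitMultiplicative ∧ thm61_nonsplitMultiplicative ∧
      (∀ (W : WeierstrassCurve ℚ) [W.IsElliptic] [W.IsGloballyMinimal] (p : ℕ) [Fact p.Prime],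
        greenberg_stevens (W := W) (p := p)) ∧
      exists_isNewformOf ∧
      (∀ (K : Type) [Field K] [NumberField K], poitouTate_selmerStructure_duality K) ∧
      (∀ (K : Type) [Field K] [NumberField K], poitouTate_sha_tateDual K) ∧
      hsieh2014_exists_anticyclotomicPAdicLFunction ∧
      (∀ (N : ℕ) [NeZero N] (W : WeierstrassCurve ℚ) (K : Type) [Field K] [NumberField K],
        gross_zagier N W K) ∧
      (∀ (N : ℕ) [NeZero N] (W : WeierstrassCurve ℚ) (K : Type) [Field K] [NumberField K],
        kolyvagin N W K) ∧
      rank_eq_analyticRank_of_analyticRank_le_one ∧ HoffsteinLuo1997_exists_twist_L_one_ne_zero ∧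
      mazur_not_dvd_maninConstant_of_odd ∧ bsdRHS_eq_of_isIsogenous) ∧
      thm210_thm211_bdpDisplay_pNew)
    (h2 : (∀ (W : WeierstrassCurve ℚ) [W.IsElliptic] [W.IsGloballyMinimal] (p : ℕ) [Fact p.Prime],
        p = 3 → CellC W p → ¬ W.HasSplitMultiplicativeReductionAtPrime p → NonsplitBDPValueOnTreeInt W p) ∧
      (∀ (W : WeierstrassCurve ℚ) [W.IsElliptic] [W.IsGloballyMinimal] (p : ℕ) [Fact p.Prime],
        p = 3 → CellC W p → W.HasSplitMultiplicativeReductionAtPrime p → SplitBDPValueOnTreeInt W p))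
    (h3 : (∀ (W : WeierstrassCurve ℚ) [W.IsElliptic] [W.IsGloballyMinimal] (p : ℕ) [Fact p.Prime],
        CellC W p → ¬ W.HasSplitMultiplicativeReductionAtPrime p → NonsplitIMCEqOnTreeIntOther W p) ∧
      (∀ (W : WeierstrassCurve ℚ) [W.IsElliptic] [W.IsGloballyMinimal] (p : ℕ) [Fact p.Prime],
        CellC W p → W.HasSplitMultiplicativeReductionAtPrime p → SplitIMCEqOnTreeIntOther W p))
    (hGVp : ∀ (W : WeierstrassCurve ℚ) [W.IsElliptic] [W.IsGloballyMinimal] (p : ℕ) [Fact p.Prime],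
        CellC W p → GVPar W p →
      ∀ (K : Type) [Field K] [NumberField K], IsImaginaryQuadratic K →
        Odd (NumberField.discr K) → NumberField.discr K < -4 →
        SatisfiesHeegnerHypothesis (W.conductorNorm ℤ) K → SatisfiesHeegnerHypothesis p K →
        (W.quadraticTwist (NumberField.discr K : ℚ)).entireLFunction 1 ≠ 0 →
      ∀ (Wd : WeierstrassCurve ℚ) [Wd.IsElliptic] [Wd.IsGloballyMinimal],
        (∃ C : VariableChange ℚ, C • Wd = W.quadraticTwist (NumberField.discr K : ℚ)) →
        Wd.analyticRank = 0 → PPartRankZero Wd p) :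
    Summit.BirchSwinnertonDyer.BirchSwinnertonDyer.Theses.EisensteinPrimes.BSDpOnCellC := by
  obtain ⟨⟨hGV, hWu, hJs, hJn, hGS, hnf, hPT, hPT2, hH, hGZ, hKo, hGZK, hHL, hMaz, hCassels⟩, hCS⟩ :=
    hPub
  obtain ⟨h2three, h2sthree⟩ := h2
  obtain ⟨h3n, h3s⟩ := h3
  -- the eight PROVED published inputs, by name
  have hHs : exists_isSplitMultCanonical := SteinWuthrich2013.exists_isSplitMultCanonical_holds
  have hHn : exists_isMultCanonical := SteinWuthrich2013.exists_isMultCanonical_holds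
  have hpar : nonempty_modularParametrizationData :=
    nonempty_modularParametrizationData_iff_exists_isNewformOf_unconditional.mpr hnf
  have hEP : ∀ (K : Type) [Field K] [NumberField K] (v : HeightOneSpectrum (𝓞 K)),
      localEulerPoincareCharacteristic (v.adicCompletion K) :=
    fun K _ _ v ↦ X11b.LocBridge.localEulerPoincareCharacteristic_adicCompletionEP K v
  have hcd : fieldCdLE_two_of_numberField :=
    Literature.NumberTheory.GaloisRepresentations.fieldCdLE_two_of_numberField_holds
  have hBr : ∀ (K : Type) [Field K] [NumberField K] (p : ℕ) [Fact p.Prime],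
      ZpExtension.decomp_not_le_kerSubgroup_of_isAnticyclotomic K p :=
    fun K _ _ p _ ↦ ZpExtension.decomp_not_le_kerSubgroup_of_isAnticyclotomic_holds (K := K) (p := p)
  have hHP : ∀ (N : ℕ) [NeZero N] (W : WeierstrassCurve ℚ) (K : Type) [Field K] [NumberField K],
      heegnerPointComplex_mem_range_map N W K :=
    fun N _ W K _ _ ↦ heegnerPointComplex_mem_range_map_holds N W K
  have hEd : edixhoven_optimalManinConstant_integral :=
    ModularForms.edixhoven_optimalManinConstant_integral_holds
  unfold Summit.BirchSwinnertonDyer.BirchSwinnertonDyer.Theses.EisensteinPrimes.BSDpOnCellC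
  intro W _ _ p _ hc
  have hmod : hasEntireLFunction_rat := hasEntireLFunction_rat_of_exists_isNewformOf hnf
  have hp : p.Prime := Fact.out
  -- `p` is an odd prime: either `5 ≤ p` or `p = 3`
  have hp35 : 5 ≤ p ∨ p = 3 := by
    by_cases hp5 : 5 ≤ p
    · exact Or.inl hp5
    · right
      have hp2 : p ≠ 2 := hc.2.1
      have h2le := hp.two_le
      interval_cases p
      · exact absurd rfl hp2
      · rfl
      · exact absurd hp (by decide)
  -- the Manin condition moved to the optimal curve; the partner at `W₀` by parity (Tate-free transport)
  refine bsdp_of_cellC_of_forall_isIsogenous hEd hMaz hCassels hpar hnf hGZK W p hc ?_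
  intro W₀ _ _ hiso hc₀ hMan₀
  have hpartner₀ : ∀ (K : Type) [Field K] [NumberField K], IsImaginaryQuadratic K →
        Odd (NumberField.discr K) → NumberField.discr K < -4 →
        SatisfiesHeegnerHypothesis (W₀.conductorNorm ℤ) K → SatisfiesHeegnerHypothesis p K →
        (W₀.quadraticTwist (NumberField.discr K : ℚ)).entireLFunction 1 ≠ 0 →
      ∀ (Wd : WeierstrassCurve ℚ) [Wd.IsElliptic] [Wd.IsGloballyMinimal],
        (∃ C : VariableChange ℚ, C • Wd = W₀.quadraticTwist (NumberField.discr K : ℚ)) →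
        Wd.analyticRank = 0 → PPartRankZero Wd p := by
    by_cases hgv₀ : GVPar W₀ p
    · exact hGVp W₀ p hc₀ hgv₀
    · intro K _ _ hK _ _ _ hHp _ Wd _ _ hWd hrd
      exact pPartRankZero_twist_of_not_gvPar hGV hWu hJs hJn hHs hHn hGZK hmod hpar hGS W₀ p hc₀.2 hgv₀ K
        hK hHp Wd hWd hrd
  by_cases hs : W₀.HasSplitMultiplicativeReductionAtPrime p
  · rcases hp35 with hp5 | hp3
    · exact bsdp_of_cellC_of_split_of_manin_of_pNewValue_of_imcIntOther_of_partner W₀ p hnf hPT hPT2 hEP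
        hBr hH hCS hGZ hKo hHP hGZK hHL hp5 hc₀ hs hMan₀ (h3s W₀ p hc₀ hs) hpartner₀
    · exact bsdp_of_cellC_of_split_of_manin_of_intResidualsOther_of_partner W₀ p hnf hPT hPT2 hEP hBr hH
        hGZ hKo hHP hGZK hHL hc₀ hs hMan₀ (h2sthree W₀ p hp3 hc₀ hs) (h3s W₀ p hc₀ hs) hpartner₀
  · rcases hp35 with hp5 | hp3
    · exact bsdp_of_cellC_of_not_split_of_manin_of_pNewValue_of_imcIntOther_of_partner W₀ p hnf hPT hPT2
        hEP hcd hBr hH hCS hGZ hKo hHP hGZK hHL hp5 hc₀ hs hMan₀ (h3n W₀ p hc₀ hs) hpartner₀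
    · exact bsdp_of_cellC_of_not_split_of_manin_of_intResidualsOther_of_partner W₀ p hnf hPT hPT2 hEP hcd
        hBr hH hGZ hKo hHP hGZK hHL hc₀ hs hMan₀ (h2three W₀ p hp3 hc₀ hs) (h3n W₀ p hc₀ hs) hpartner₀

/-- **Crux 4 `BSDpOnCellC` AT THE PRE TIER with crux 3 replaced by the ψ-odd partner supply.** From the 16
published facts + [cas-split] (`hPub`), the value atom at `p = 3` (`h2`), KELLER–YIN THM. D BY NAME (`hD`,
PREPRINT) and `hGVp` = «`PPartRankZero` for the admissible rank-zero quadratic twists of the ψ-ODD X2c curves»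
— the honest statement of what crux 4 consumes of rung K5 (implied by `MazurMCOnCellB`; compare p489431, which
carries `MazurMCOnCellB` itself). `bsdpOnCellC_of_imcIntOther_of_gvPartner` with the `stub_c3` slot filled
from `hD` by name (p487050). A `conditional-result`: credits nothing, books nothing.
[claim: KellerYin2024, status: under-review] [cite: KellerYin2024, Thm. D = Thm. 5.1.3 (arXiv:2402.12781v2 L306–L309)]
[cite: GreenbergVatsal2000, Thm. (1.3) and §2 p. 28] [cite: Hsieh2014, Thm. 1 (arXiv:1112.1580 pp. 3–4)]
[cite: Castella2018Exceptional, Thm. 2.10 and Thm. 2.11 (arXiv:1507.04260 pp. 13–14)]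
[cite: CastellaEtAl2021, Thm. 5.3.1] [cite: Miller2011LMS, Def. 1.1] -/
theorem bsdpOnCellC_of_thmD_OPEN_of_gvPartner
    (hPub : (lambdaMu_multiplicative_of_gvPar ∧ thm16_charIdeal_dvd_multiplicative_of_reducible ∧
      thm61_splitMultiplicative ∧ thm61_nonsplitMultiplicative ∧
      (∀ (W : WeierstrassCurve ℚ) [W.IsElliptic] [W.IsGloballyMinimal] (p : ℕ) [Fact p.Prime],
        greenberg_stevens (W := W) (p := p)) ∧
      exists_isNewformOf ∧
      (∀ (K : Type) [Field K] [NumberField K], poitouTate_selmerStructure_duality K) ∧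
      (∀ (K : Type) [Field K] [NumberField K], poitouTate_sha_tateDual K) ∧
      hsieh2014_exists_anticyclotomicPAdicLFunction ∧
      (∀ (N : ℕ) [NeZero N] (W : WeierstrassCurve ℚ) (K : Type) [Field K] [NumberField K],
        gross_zagier N W K) ∧
      (∀ (N : ℕ) [NeZero N] (W : WeierstrassCurve ℚ) (K : Type) [Field K] [NumberField K],
        kolyvagin N W K) ∧
      rank_eq_analyticRank_of_analyticRank_le_one ∧ HoffsteinLuo1997_exists_twist_L_one_ne_zero ∧
      mazur_not_dvd_maninConstant_of_odd ∧ bsdRHS_eq_of_isIsogenous) ∧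
      thm210_thm211_bdpDisplay_pNew)
    (h2 : (∀ (W : WeierstrassCurve ℚ) [W.IsElliptic] [W.IsGloballyMinimal] (p : ℕ) [Fact p.Prime],
        p = 3 → CellC W p → ¬ W.HasSplitMultiplicativeReductionAtPrime p → NonsplitBDPValueOnTreeInt W p) ∧
      (∀ (W : WeierstrassCurve ℚ) [W.IsElliptic] [W.IsGloballyMinimal] (p : ℕ) [Fact p.Prime],
        p = 3 → CellC W p → W.HasSplitMultiplicativeReductionAtPrime p → SplitBDPValueOnTreeInt W p))
    (hD : KellerYin2024.thmD_imcMult_exists_isBDPLFunction_isTorsion_charIdeal_eq_OPEN)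
    (hGVp : ∀ (W : WeierstrassCurve ℚ) [W.IsElliptic] [W.IsGloballyMinimal] (p : ℕ) [Fact p.Prime],
        CellC W p → GVPar W p →
      ∀ (K : Type) [Field K] [NumberField K], IsImaginaryQuadratic K →
        Odd (NumberField.discr K) → NumberField.discr K < -4 →
        SatisfiesHeegnerHypothesis (W.conductorNorm ℤ) K → SatisfiesHeegnerHypothesis p K →
        (W.quadraticTwist (NumberField.discr K : ℚ)).entireLFunction 1 ≠ 0 →
      ∀ (Wd : WeierstrassCurve ℚ) [Wd.IsElliptic] [Wd.IsGloballyMinimal],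
        (∃ C : VariableChange ℚ, C • Wd = W.quadraticTwist (NumberField.discr K : ℚ)) →
        Wd.analyticRank = 0 → PPartRankZero Wd p) :
    Summit.BirchSwinnertonDyer.BirchSwinnertonDyer.Theses.EisensteinPrimes.BSDpOnCellC :=
  bsdpOnCellC_of_imcIntOther_of_gvPartner hPub h2
    ⟨forall_nonsplitIMCEqOnTreeIntOther_of_thmD_OPEN hD, forall_splitIMCEqOnTreeIntOther_of_thmD_OPEN hD⟩
    hGVp

end OfThmD

end Summit.BirchSwinnertonDyer.BirchSwinnertonDyer.Theorems.Reoriented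

end
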